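import Summits.HubbardSuperconductivity.HubbardSuperconductivity.Theorems.AnisotropyChordTransferFibre3RowDLoopWMajE
import Summits.HubbardSuperconductivity.HubbardSuperconductivity.Theorems.AnisotropyChordTransferFibre3RowDOrbit

/-!
# Route `AnisotropyChord` / H0 rotor rung, row D (KT-2a) Stage 1.5: the cell certificate with a GENERIC zone constant, and the `c_W` program

Continuation of `…RowDLoopW` / `…RowDLoopWNorms` / `…RowDLoopWMajE`.  The Stage-1 kernel cell program of `…RowDCellCheck` /
`…RowDOrbit` with the zone-constant atom made a parameter `czE : RExpr`: ★ `termEC`, ★ `classCheckC`, ★ `class_leC`,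
★★ `lowG_of_classChecksC` (per-class table form) and ★★ `lowG_of_orbitChecksC` (orbit form, 6 kernel checks), sound whenever
`czE ↦ cz ≥ 0` with `∀ q e, (w_e(q)g(q))² ≤ cz·g(q)` at the ground profile.  THE `c_W` PROGRAM (Stage 1.5): atom ★ `cWE = 2ê₁/(2ê₁ − ν)`
(★ `eval_cWE : cWE ↦ c_W(λ₂) = 2ε₁/(2ε₁ − λ₂)`), ★ `termEW`, `majLoopEW`, ★ `classCheckW := classCheckC cWE`, and the two soundness
theorems with NO extra hypothesis — ★★★ `lowG_of_classChecksW`, ★★★ `lowG_of_orbitChecksW`: a passing `c_W` cell certificate gives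
`lowGForm ≤ a_D·η_eff·U` for every `L ≥ 128` on the cell (the `hKT2a` hypothesis of `gm3_of_cell`), by `RowD.wg_hypW`.
Effect: every `c_Z ≈ 2.5–2.7` in the N-type and boundary majorants becomes `c_W ≈ 1.00–1.03` (×2.5 on the linear entries, ×1.6 on
the square-root entries); the closed part, the M-loops and the `NT` part are unchanged.
Prover seat `hubbard-h0-rotor-p1` g31 (route lead); helper for piece A = stmt-HubbardSuperconductivity-23918 of rung 19089
(`--supports`, helper class).  Nothing here proves superconductivity in the Hubbard model; lemmas for ONE row of ONE conditional
reduction.  Tree imports only; no sorry.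
-/

set_option linter.dupNamespace false
set_option autoImplicit false

open scoped BigOperators
open Literature.Analysis.ValidatedNumerics

namespace Summit.HubbardSuperconductivity.HubbardSuperconductivity.Theorems.AnisotropyChord.Transfer.Fibre3

namespace RowD

open RowC L2.N1

variable (L : ℕ) [NeZero L]

/-! ## The generic program -/

/-- one class with a generic zone-constant atom `czE`: `(|x| + majEC czE)²/(ê_k − τhi)` (`x` = the real part of the closed pair `rhoE`). -/
def termEC (czE : RExpr) (τlo τhi : ℚ) (k₂ k₃ : ℤ × ℤ) : RExpr :=
  .mul (.sq (.add (.abs (rhoE k₂ k₃).1) (majEC czE τlo τhi k₂ k₃))) (.inv (.sub (denHE k₂ k₃) (cst τhi)))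

/-- ★ the check of ONE class against a rational budget `b`, generic zone-constant atom `czE`: `(|x_k| + majE)²/(ê_k − τhi) ≤ b` on the row-D box. -/
def classCheckC (czE : RExpr) (c : L2.NamedCell) (a1 a2 τlo τhi : ℚ) (pi : ℕ × ℕ) (kk : (ℤ × ℤ) × (ℤ × ℤ)) (b : ℚ) : Bool :=
  match rowDBox c a1 a2 pi with
  | none => false
  | some B => rexprLeOn (termEC czE τlo τhi kk.1 kk.2) b B pi

/-! ## Soundness of the generic program -/

section sound
variable (Δ lam2 : ℝ) (f : Tor L → ℝ)

/-- one class, generic zone constant: `|R̂′(k̄)|²/(V²·den(k̄)) ≤ V²t·(termEC czE).eval`. [folklore] -/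
theorem class_leC (czE : RExpr) {cz : ℝ} (hcz0 : 0 ≤ cz)
    (hwg : ∀ q : Tor L, ∀ e ∈ E4, (wnorm L q (B1.toTor L e) * gres L lam2 q) ^ 2 ≤ cz * gres L lam2 q)
    (hcz : czE.eval (xTrueD L Δ lam2 f) = cz) (hL : 128 ≤ L) (hΔ0 : 0 ≤ Δ) (hΔ1 : Δ < 1) (hf : IsGroundTwoMagnon L Δ lam2 f)
    (τlo τhi : ℚ) (hτlo : (τlo : ℝ) * (2 * Real.pi / L) ^ 2 ≤ Tplus L Δ f) (hτhi : Tplus L Δ f ≤ (τhi : ℝ) * (2 * Real.pi / L) ^ 2)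
    (he1 : (τhi : ℝ) - 2 * (eps1 L / (2 * Real.pi / L) ^ 2) ≤ -1 / 1000)
    {kk : (ℤ × ℤ) × (ℤ × ℤ)} (hkk : kk ∈ lowList) :
    Complex.normSq (cfgDFT L (resid L Δ f) (B1.toTor L kk.1) (B1.toTor L kk.2))
        / (((L : ℝ) ^ 2) ^ 2 * den L (Tplus L Δ f) (B1.toTor L kk.1) (B1.toTor L kk.2))
      ≤ ((L : ℝ) ^ 2) ^ 2 * (2 * Real.pi / L) ^ 2 * (termEC czE τlo τhi kk.1 kk.2).eval (xTrueD L Δ lam2 f) := by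
  have hLpos : (0 : ℝ) < L := by exact_mod_cast (show 0 < L by omega)
  have ht : 0 < (2 * Real.pi / L : ℝ) ^ 2 := by positivity
  have hV : (0 : ℝ) < (L : ℝ) ^ 2 := by positivity
  obtain ⟨hok, hden⟩ := ok_of_mem hkk
  -- the norm bound
  have hR := rhat_norm_leC L Δ lam2 f czE hcz0 hwg hcz hL hΔ0 hΔ1 hf τlo τhi hτlo hτhi hok
  set A : ℝ := |(rhoE kk.1 kk.2).1.eval (xTrueD L Δ lam2 f)| + (majEC czE τlo τhi kk.1 kk.2).eval (xTrueD L Δ lam2 f) with hA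
  -- the denominator
  have hmem : (B1.toTor L kk.1, B1.toTor L kk.2) ∈ lowSet L := mem_lowSet_of_mem_lowList L (by omega) hkk
  have hdlow := den_ge_of_mem_lowSet L (by omega) (Tplus L Δ f) hmem
  have ed := eval_denHE L Δ lam2 f (by omega) hden (Tplus L Δ f)
  set dh : ℝ := (denHE kk.1 kk.2).eval (xTrueD L Δ lam2 f) with hdh
  have hden_eq : den L (Tplus L Δ f) (B1.toTor L kk.1) (B1.toTor L kk.2) = (2 * Real.pi / L) ^ 2 * dh - Tplus L Δ f := by
    rw [hdh]; linarith [ed]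
  have hpos : 0 < dh - τhi := by
    have h2 : 2 * eps1 L ≤ (2 * Real.pi / L) ^ 2 * dh := by simp only at hdlow; linarith [hden_eq]
    have he : eps1 L / (2 * Real.pi / L) ^ 2 ≤ dh / 2 := by rw [div_le_iff₀ ht]; linarith
    linarith
  have hden_lb : (2 * Real.pi / L) ^ 2 * (dh - τhi) ≤ den L (Tplus L Δ f) (B1.toTor L kk.1) (B1.toTor L kk.2) := by
    rw [hden_eq]; nlinarith
  -- evaluate termE
  have eT : (termEC czE τlo τhi kk.1 kk.2).eval (xTrueD L Δ lam2 f) = A ^ 2 * (dh - τhi)⁻¹ := by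
    simp only [termEC, RExpr.eval, cst, hA, hdh]
  rw [eT, Complex.normSq_eq_norm_sq]
  have hsq : ‖cfgDFT L (resid L Δ f) (B1.toTor L kk.1) (B1.toTor L kk.2)‖ ^ 2 ≤ (((L : ℝ) ^ 2) ^ 2 * (2 * Real.pi / L) ^ 2 * A) ^ 2 :=
    pow_le_pow_left₀ (norm_nonneg _) hR 2
  calc ‖cfgDFT L (resid L Δ f) (B1.toTor L kk.1) (B1.toTor L kk.2)‖ ^ 2
          / (((L : ℝ) ^ 2) ^ 2 * den L (Tplus L Δ f) (B1.toTor L kk.1) (B1.toTor L kk.2))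
      ≤ (((L : ℝ) ^ 2) ^ 2 * (2 * Real.pi / L) ^ 2 * A) ^ 2 / (((L : ℝ) ^ 2) ^ 2 * ((2 * Real.pi / L) ^ 2 * (dh - τhi))) := by
        apply div_le_div₀ (by positivity) hsq (by positivity)
        exact mul_le_mul_of_nonneg_left hden_lb (by positivity)
    _ = ((L : ℝ) ^ 2) ^ 2 * (2 * Real.pi / L) ^ 2 * (A ^ 2 * (dh - τhi)⁻¹) := by
        field_simp



/-- ★★★ **PER-CLASS FORM, generic zone constant**: a budget table `tbl = [(k, b_k)]` listing the classes of `lowList` in order, each row certified by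
`classCheckC czE` (one small kernel `decide` per class), with `Σ b_k ≤ 3·(98696/10000)·aD·ν₁·τlo` (`9.8696 < π²`, `ν₁ = n₁/νd` the cell's
lower `ν`), the `ê₁` check and the `τ` check give `lowG ≤ a_D·η_eff·U` on the cell. -/
theorem lowG_of_classChecksC (czE : RExpr) (c : L2.NamedCell) {cz : ℝ} (hcz0 : 0 ≤ cz)
    (hwg : ∀ q : Tor L, ∀ e ∈ E4, (wnorm L q (B1.toTor L e) * gres L lam2 q) ^ 2 ≤ cz * gres L lam2 q)
    (hcz : czE.eval (xTrueD L Δ lam2 f) = cz)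
    (a1 a2 aD τlo τhi : ℚ) (pi piT : ℕ × ℕ) (tbl : List (((ℤ × ℤ) × (ℤ × ℤ)) × ℚ))
    (htbl : tbl.map Prod.fst = lowList)
    (hcls : (tbl.all fun p => classCheckC czE c a1 a2 τlo τhi pi p.1 p.2) = true)
    (hsum : (tbl.map Prod.snd).sum ≤ 3 * (98696 / 10000) * aD * ((c.n1 : ℚ) / c.νd) * τlo)
    (haD : 0 ≤ aD) (hτlo0 : 0 ≤ τlo) (he1 : e1Check c a1 a2 τhi pi = true) (hτ : tauCheck c a1 a2 τlo τhi piT = true)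
    (hc : c.check = true) (hL : 128 ≤ L)
    (hΔ0 : 0 ≤ Δ) (hΔ1 : Δ < 1) (hf : IsGroundTwoMagnon L Δ lam2 f)
    (hν1 : (c.n1 : ℝ) / c.νd ≤ lam2 / (2 * Real.pi / L) ^ 2) (hν2 : lam2 / (2 * Real.pi / L) ^ 2 ≤ (c.n2 : ℝ) / c.νd)
    (ha1 : ((a1 : ℚ) : ℝ) ≤ Δ * f (K1 L)) (ha2 : Δ * f (K1 L) ≤ ((a2 : ℚ) : ℝ)) :
    lowGForm L Δ f ≤ (aD : ℝ) * etaEff L lam2 * Uunit L Δ f := by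
  have hLpos : (0 : ℝ) < L := by exact_mod_cast (show 0 < L by omega)
  have ht : 0 < (2 * Real.pi / L : ℝ) ^ 2 := by positivity
  have hV : (0 : ℝ) < (L : ℝ) ^ 2 := by positivity
  obtain ⟨hτlo, hτhi⟩ := tau_of_tauCheck L Δ lam2 f c a1 a2 τlo τhi piT hτ hc hL hΔ0 hΔ1 hf hν1 hν2 ha1 ha2
  -- the box and the `ê₁` check
  unfold e1Check at he1
  split at he1
  · exact absurd he1 (by simp)
  · rename_i B hB
    have hmem := rowDBox_mem L Δ lam2 f c a1 a2 pi hB hc hL hΔ0 hΔ1 hf hν1 hν2 ha1 ha2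
    have e1 := rexprLeOn_sound he1 _ hmem
    simp only [RExpr.eval, cst, vE1, xTrueD_e1] at e1
    push_cast at e1
    have he1' : (τhi : ℝ) - 2 * (eps1 L / (2 * Real.pi / L) ^ 2) ≤ -1 / 1000 := by linarith
    -- each row of the table: `term(k) ≤ V²t·termE.eval ≤ V²t·b_k`
    have hcl : ∀ p ∈ tbl,
        Complex.normSq (cfgDFT L (resid L Δ f) (B1.toTor L p.1.1) (B1.toTor L p.1.2))
          / (((L : ℝ) ^ 2) ^ 2 * den L (Tplus L Δ f) (B1.toTor L p.1.1) (B1.toTor L p.1.2))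
        ≤ ((L : ℝ) ^ 2) ^ 2 * (2 * Real.pi / L) ^ 2 * ((p.2 : ℚ) : ℝ) := by
      intro p hp
      have hkk : p.1 ∈ lowList := htbl ▸ List.mem_map_of_mem hp
      have h1 := class_leC L Δ lam2 f czE hcz0 hwg hcz hL hΔ0 hΔ1 hf τlo τhi hτlo hτhi he1' hkk
      have h2 := List.all_eq_true.mp hcls p hp
      unfold classCheckC at h2
      rw [hB] at h2
      have h3 := rexprLeOn_sound h2 _ hmem
      exact h1.trans (mul_le_mul_of_nonneg_left h3 (by positivity))
    have hsum' : lowGForm L Δ f ≤ ((L : ℝ) ^ 2) ^ 2 * (2 * Real.pi / L) ^ 2 * (((tbl.map Prod.snd).sum : ℚ) : ℝ) := by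
      rw [lowGForm_eq_listsum L Δ f (by omega), ← htbl, List.map_map]
      have := listsum_le tbl _ (fun p => ((L : ℝ) ^ 2) ^ 2 * (2 * Real.pi / L) ^ 2 * ((p.2 : ℚ) : ℝ)) hcl
      refine this.trans (le_of_eq ?_)
      rw [List.sum_map_mul_left, Rat.cast_list_sum, List.map_map]
      rfl
    -- the budget inequality in `ℝ`
    have hsumR : (((tbl.map Prod.snd).sum : ℚ) : ℝ) ≤ 3 * (98696 / 10000) * aD * ((c.n1 : ℝ) / c.νd) * τlo := by
      have := (Rat.cast_le (K := ℝ)).mpr hsum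
      push_cast at this ⊢
      exact this
    have hπ2 : (98696 / 10000 : ℝ) ≤ Real.pi ^ 2 := by nlinarith [Real.pi_gt_d6, Real.pi_pos]
    have haD' : (0 : ℝ) ≤ aD := by exact_mod_cast haD
    have hτ0' : (0 : ℝ) ≤ τlo := by exact_mod_cast hτlo0
    have hlam : 0 < lam2 := lam2_pos L (by omega) hΔ1 hf.1
    have hlt : 0 ≤ lam2 / (2 * Real.pi / L) ^ 2 := by positivity
    have hν' : 3 * (98696 / 10000) * (aD : ℝ) * ((c.n1 : ℝ) / c.νd) * τlo
        ≤ 3 * Real.pi ^ 2 * aD * (lam2 / (2 * Real.pi / L) ^ 2) * τlo := by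
      have h1 : 0 ≤ (aD : ℝ) * τlo * (lam2 / (2 * Real.pi / L) ^ 2 - (c.n1 : ℝ) / c.νd) :=
        mul_nonneg (mul_nonneg haD' hτ0') (sub_nonneg.2 hν1)
      have h2 : 0 ≤ (aD : ℝ) * τlo * (lam2 / (2 * Real.pi / L) ^ 2) * (Real.pi ^ 2 - 98696 / 10000) :=
        mul_nonneg (mul_nonneg (mul_nonneg haD' hτ0') hlt) (sub_nonneg.2 hπ2)
      nlinarith [h1, h2]
    have hRHS : (aD : ℝ) * etaEff L lam2 * Uunit L Δ f
        = ((L : ℝ) ^ 2) ^ 2 * (2 * Real.pi / L) ^ 2 * (3 * Real.pi ^ 2 * aD * (lam2 / (2 * Real.pi / L) ^ 2))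
          * (Tplus L Δ f / (2 * Real.pi / L) ^ 2) := by
      have hL0 : (L : ℝ) ≠ 0 := hLpos.ne'
      have hπ : Real.pi ≠ 0 := Real.pi_ne_zero
      unfold Uunit etaEff
      field_simp
      ring
    rw [hRHS]
    have hτ' : (τlo : ℝ) ≤ Tplus L Δ f / (2 * Real.pi / L) ^ 2 := by rw [le_div_iff₀ ht]; exact hτlo
    have hc0 : 0 ≤ ((L : ℝ) ^ 2) ^ 2 * (2 * Real.pi / L) ^ 2 * (3 * Real.pi ^ 2 * aD * (lam2 / (2 * Real.pi / L) ^ 2)) := by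
      positivity
    have hVt : 0 ≤ ((L : ℝ) ^ 2) ^ 2 * (2 * Real.pi / L) ^ 2 := by positivity
    calc lowGForm L Δ f ≤ ((L : ℝ) ^ 2) ^ 2 * (2 * Real.pi / L) ^ 2 * (((tbl.map Prod.snd).sum : ℚ) : ℝ) := hsum'
      _ ≤ ((L : ℝ) ^ 2) ^ 2 * (2 * Real.pi / L) ^ 2 * (3 * Real.pi ^ 2 * aD * (lam2 / (2 * Real.pi / L) ^ 2) * τlo) :=
          mul_le_mul_of_nonneg_left (hsumR.trans (by linarith)) hVt
      _ = ((L : ℝ) ^ 2) ^ 2 * (2 * Real.pi / L) ^ 2 * (3 * Real.pi ^ 2 * aD * (lam2 / (2 * Real.pi / L) ^ 2)) * τlo := by ring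
      _ ≤ _ := mul_le_mul_of_nonneg_left hτ' hc0

/-- ★★★ **ORBIT FORM of the row-D cell certificate, generic zone constant**: representatives `reps = [(r_j, b_j)]` (each `r_j ∈ lowList` and passing ONE
kernel class check `classCheckC czE … r_j b_j`, `hrepsCls`; `r_j ∈ lowList`, `hrepsMem`), an orbit table `orb = [(k, j, w)]` listing `lowList` with `w·k = r_j` (`orbitRowOk`,
pure integer `decide`), the budget `Σ_k b_{j(k)} ≤ 3·(98696/10⁴)·a_D·ν₁·τlo`, the `ê₁` check and the `τ` check give
`lowGForm ≤ a_D·η_eff·U` on the cell for every `L ≥ 128` — the `hKT2a` hypothesis of `gm3_of_cell`. -/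
theorem lowG_of_orbitChecksC (czE : RExpr) (c : L2.NamedCell) {cz : ℝ} (hcz0 : 0 ≤ cz)
    (hwg : ∀ q : Tor L, ∀ e ∈ E4, (wnorm L q (B1.toTor L e) * gres L lam2 q) ^ 2 ≤ cz * gres L lam2 q)
    (hcz : czE.eval (xTrueD L Δ lam2 f) = cz)
    (a1 a2 aD τlo τhi : ℚ) (pi piT : ℕ × ℕ)
    (reps : List (((ℤ × ℤ) × (ℤ × ℤ)) × ℚ)) (orb : List (((ℤ × ℤ) × (ℤ × ℤ)) × (ℕ × List ℕ)))
    (hrepsMem : (reps.all fun p => decide (p.1 ∈ lowList)) = true)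
    (hrepsCls : (reps.all fun p => classCheckC czE c a1 a2 τlo τhi pi p.1 p.2) = true)
    (horb : orb.map Prod.fst = lowList) (hok : (orb.all (orbitRowOk reps)) = true)
    (hsum : (orb.map (orbitBudget reps)).sum ≤ 3 * (98696 / 10000) * aD * ((c.n1 : ℚ) / c.νd) * τlo)
    (haD : 0 ≤ aD) (hτlo0 : 0 ≤ τlo) (he1 : e1Check c a1 a2 τhi pi = true) (hτ : tauCheck c a1 a2 τlo τhi piT = true)
    (hc : c.check = true) (hL : 128 ≤ L)
    (hΔ0 : 0 ≤ Δ) (hΔ1 : Δ < 1) (hf : IsGroundTwoMagnon L Δ lam2 f)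
    (hν1 : (c.n1 : ℝ) / c.νd ≤ lam2 / (2 * Real.pi / L) ^ 2) (hν2 : lam2 / (2 * Real.pi / L) ^ 2 ≤ (c.n2 : ℝ) / c.νd)
    (ha1 : ((a1 : ℚ) : ℝ) ≤ Δ * f (K1 L)) (ha2 : Δ * f (K1 L) ≤ ((a2 : ℚ) : ℝ)) :
    lowGForm L Δ f ≤ (aD : ℝ) * etaEff L lam2 * Uunit L Δ f := by
  obtain ⟨hτlo, hτhi⟩ := tau_of_tauCheck L Δ lam2 f c a1 a2 τlo τhi piT hτ hc hL hΔ0 hΔ1 hf hν1 hν2 ha1 ha2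
  -- the box and the `ê₁` check
  unfold e1Check at he1
  split at he1
  · exact absurd he1 (by simp)
  · rename_i B hB
    have hmem := rowDBox_mem L Δ lam2 f c a1 a2 pi hB hc hL hΔ0 hΔ1 hf hν1 hν2 ha1 ha2
    have e1 := rexprLeOn_sound he1 _ hmem
    simp only [RExpr.eval, cst, vE1, xTrueD_e1] at e1
    push_cast at e1
    have he1' : (τhi : ℝ) - 2 * (eps1 L / (2 * Real.pi / L) ^ 2) ≤ -1 / 1000 := by linarith
    -- the representatives: `T(r_j) ≤ V²t·b_j`
    have hrep : ∀ r ∈ reps, lowTerm L Δ f (B1.toTor L r.1.1) (B1.toTor L r.1.2)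
        ≤ ((L : ℝ) ^ 2) ^ 2 * (2 * Real.pi / L) ^ 2 * ((r.2 : ℚ) : ℝ) := by
      intro r hr
      have hmemL : r.1 ∈ lowList := of_decide_eq_true (List.all_eq_true.mp hrepsMem r hr)
      have hcls := List.all_eq_true.mp hrepsCls r hr
      have h1 := class_leC L Δ lam2 f czE hcz0 hwg hcz hL hΔ0 hΔ1 hf τlo τhi hτlo hτhi he1' hmemL
      unfold classCheckC at hcls
      rw [hB] at hcls
      have h3 := rexprLeOn_sound hcls _ hmem
      exact h1.trans (mul_le_mul_of_nonneg_left h3 (by positivity))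
    -- the rows: `T(k) = T(w·k) = T(r_j) ≤ V²t·b_j`
    refine lowG_of_rowBounds L Δ lam2 f (by omega) hΔ1 hf c aD τlo (orb.map fun row => (row.1, orbitBudget reps row))
      (by rw [List.map_map]; exact horb) ?_ (by rw [List.map_map]; exact hsum) haD hτlo0 hτlo hν1
    intro p hp
    obtain ⟨row, hrow, rfl⟩ := List.mem_map.mp hp
    have hok1 := List.all_eq_true.mp hok row hrow
    unfold orbitRowOk at hok1
    unfold orbitBudget
    split at hok1
    · exact absurd hok1 (by simp)
    · rename_i r hr
      have hw : wordZ row.2.2 row.1 = r.1 := of_decide_eq_true hok1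
      have hrmem : r ∈ reps := List.mem_of_getElem? hr
      have key := lowTerm_wordZ L (by omega) hf row.2.2 row.1
      rw [hw] at key
      show lowTerm L Δ f (B1.toTor L row.1.1) (B1.toTor L row.1.2) ≤ _
      rw [← key]
      exact hrep r hrmem

end sound

/-! ## The `c_W` program (Stage 1.5) -/

/-- ★ the `c_W` atom in hat units: `2ê₁/(2ê₁ − ν)` (`ê₁ = ε₁/θ²` = coordinate 16, `ν` = coordinate 2). -/
def cWE : RExpr := .mul (.mul (cst 2) vE1) (.inv (.sub (.mul (cst 2) vE1) vNu))

/-- one class of the `c_W` program. -/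
def termEW (τlo τhi : ℚ) (k₂ k₃ : ℤ × ℤ) : RExpr := termEC cWE τlo τhi k₂ k₃

/-- the loop majorant of the `c_W` program (for probes). -/
def majLoopEW (k₂ k₃ : ℤ × ℤ) : RExpr := majLoopEC cWE k₂ k₃

/-- ★ the `c_W` class check: `(|x_k| + majEC cWE)²/(ê_k − τhi) ≤ b` on the row-D box. -/
def classCheckW (c : L2.NamedCell) (a1 a2 τlo τhi : ℚ) (pi : ℕ × ℕ) (kk : (ℤ × ℤ) × (ℤ × ℤ)) (b : ℚ) : Bool :=
  classCheckC cWE c a1 a2 τlo τhi pi kk b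

section wsound
variable (Δ lam2 : ℝ) (f : Tor L → ℝ)

/-- ★ `cWE ↦ c_W(λ₂)` at the row-D vector of a ground profile (`L ≥ 128`, `0 ≤ Δ`; `λ₂ < 2ε₁`). [folklore] -/
theorem eval_cWE (hL : 128 ≤ L) (hΔ0 : 0 ≤ Δ) (hf : IsGroundTwoMagnon L Δ lam2 f) :
    cWE.eval (xTrueD L Δ lam2 f) = cW L lam2 := by
  have hLpos : (0 : ℝ) < L := by exact_mod_cast (show 0 < L by omega)
  have ht : (2 * Real.pi / L : ℝ) ^ 2 ≠ 0 := by positivity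
  have hε : 2 * eps1 L - lam2 ≠ 0 := by
    have := lam2_lt_two_eps1 L (by omega) hΔ0 hf; linarith
  simp only [cWE, cW, RExpr.eval, cst, vE1, vNu, xTrueD_e1, xTrueD_two]
  push_cast
  rw [show (2 : ℝ) * (eps1 L / (2 * Real.pi / L) ^ 2) - lam2 / (2 * Real.pi / L) ^ 2
      = (2 * eps1 L - lam2) / (2 * Real.pi / L) ^ 2 by field_simp]
  rw [inv_div]
  field_simp

/-- ★★★ **PER-CLASS FORM of the `c_W` certificate** (same shape as `lowG_of_classChecks`, with `classCheckW`). -/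
theorem lowG_of_classChecksW (c : L2.NamedCell) (a1 a2 aD τlo τhi : ℚ) (pi piT : ℕ × ℕ) (tbl : List (((ℤ × ℤ) × (ℤ × ℤ)) × ℚ))
    (htbl : tbl.map Prod.fst = lowList)
    (hcls : (tbl.all fun p => classCheckW c a1 a2 τlo τhi pi p.1 p.2) = true)
    (hsum : (tbl.map Prod.snd).sum ≤ 3 * (98696 / 10000) * aD * ((c.n1 : ℚ) / c.νd) * τlo)
    (haD : 0 ≤ aD) (hτlo0 : 0 ≤ τlo) (he1 : e1Check c a1 a2 τhi pi = true) (hτ : tauCheck c a1 a2 τlo τhi piT = true)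
    (hc : c.check = true) (hL : 128 ≤ L)
    (hΔ0 : 0 ≤ Δ) (hΔ1 : Δ < 1) (hf : IsGroundTwoMagnon L Δ lam2 f)
    (hν1 : (c.n1 : ℝ) / c.νd ≤ lam2 / (2 * Real.pi / L) ^ 2) (hν2 : lam2 / (2 * Real.pi / L) ^ 2 ≤ (c.n2 : ℝ) / c.νd)
    (ha1 : ((a1 : ℚ) : ℝ) ≤ Δ * f (K1 L)) (ha2 : Δ * f (K1 L) ≤ ((a2 : ℚ) : ℝ)) :
    lowGForm L Δ f ≤ (aD : ℝ) * etaEff L lam2 * Uunit L Δ f := by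
  obtain ⟨hcz0, hwg⟩ := wg_hypW L Δ lam2 f hL hΔ0 hΔ1 hf
  exact lowG_of_classChecksC L Δ lam2 f cWE c hcz0 hwg (eval_cWE L Δ lam2 f hL hΔ0 hf) a1 a2 aD τlo τhi pi piT tbl htbl hcls hsum
    haD hτlo0 he1 hτ hc hL hΔ0 hΔ1 hf hν1 hν2 ha1 ha2

/-- ★★★ **ORBIT FORM of the `c_W` certificate** (same shape as `lowG_of_orbitChecks`, with `classCheckW`): six kernel class checks of
the `c_W` program + the orbit table + budget + `ê₁`/`τ` checks ⟹ `lowGForm ≤ a_D·η_eff·U` on the cell for every `L ≥ 128`. -/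
theorem lowG_of_orbitChecksW (c : L2.NamedCell) (a1 a2 aD τlo τhi : ℚ) (pi piT : ℕ × ℕ)
    (reps : List (((ℤ × ℤ) × (ℤ × ℤ)) × ℚ)) (orb : List (((ℤ × ℤ) × (ℤ × ℤ)) × (ℕ × List ℕ)))
    (hrepsMem : (reps.all fun p => decide (p.1 ∈ lowList)) = true)
    (hrepsCls : (reps.all fun p => classCheckW c a1 a2 τlo τhi pi p.1 p.2) = true)
    (horb : orb.map Prod.fst = lowList) (hok : (orb.all (orbitRowOk reps)) = true)
    (hsum : (orb.map (orbitBudget reps)).sum ≤ 3 * (98696 / 10000) * aD * ((c.n1 : ℚ) / c.νd) * τlo)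
    (haD : 0 ≤ aD) (hτlo0 : 0 ≤ τlo) (he1 : e1Check c a1 a2 τhi pi = true) (hτ : tauCheck c a1 a2 τlo τhi piT = true)
    (hc : c.check = true) (hL : 128 ≤ L)
    (hΔ0 : 0 ≤ Δ) (hΔ1 : Δ < 1) (hf : IsGroundTwoMagnon L Δ lam2 f)
    (hν1 : (c.n1 : ℝ) / c.νd ≤ lam2 / (2 * Real.pi / L) ^ 2) (hν2 : lam2 / (2 * Real.pi / L) ^ 2 ≤ (c.n2 : ℝ) / c.νd)
    (ha1 : ((a1 : ℚ) : ℝ) ≤ Δ * f (K1 L)) (ha2 : Δ * f (K1 L) ≤ ((a2 : ℚ) : ℝ)) :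
    lowGForm L Δ f ≤ (aD : ℝ) * etaEff L lam2 * Uunit L Δ f := by
  obtain ⟨hcz0, hwg⟩ := wg_hypW L Δ lam2 f hL hΔ0 hΔ1 hf
  exact lowG_of_orbitChecksC L Δ lam2 f cWE c hcz0 hwg (eval_cWE L Δ lam2 f hL hΔ0 hf) a1 a2 aD τlo τhi pi piT reps orb
    hrepsMem hrepsCls horb hok hsum haD hτlo0 he1 hτ hc hL hΔ0 hΔ1 hf hν1 hν2 ha1 ha2

end wsound

end RowD

end Summit.HubbardSuperconductivity.HubbardSuperconductivity.Theorems.AnisotropyChord.Transfer.Fibre3
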